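import Summits.MatrixMultiplication.MatrixMultiplication.Theses.StrassenDefect
import Literature.Computability.AlgebraicComplexity.AsymptoticSpectrumDuality

/-!
# Route StrassenDefect — support `AsymptoticRankSubadditive`: `R̃(s ⊕ t) ≤ R̃(s) + R̃(t)`

Item `stmt-MatrixMultiplication-4076` of route `MatrixMultiplication/StrassenDefect`.

The asymptotic rank of 3-tensors over `ℂ` is subadditive under direct sum. Proof by Strassen
duality (Christandl–Vrana–Zuiddam 2023, Prop. 1.6 = Strassen 1988, Thm. 3.8; PROVED in the tree as
`strassen_duality_asymptoticRank_holds`): pick a universal spectral point `F` attaining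
`F (s ⊕ t) = R̃(s ⊕ t)`; then `F (s ⊕ t) = F s + F t` (additivity of universal spectral points) and
`F s ≤ R̃(s)`, `F t ≤ R̃(t)` (the easy half of duality).

References: V. Strassen, J. reine angew. Math. 384 (1988), Thm. 3.8; M. Christandl, P. Vrana,
J. Zuiddam, JAMS 36 (2023), Prop. 1.6; J. Zuiddam, PhD thesis (2018), Cor. 2.13.
-/

-- `Summit.<Summit>.<Problem>` is the tree's mandated summit-side namespace; for this
-- single-conjunct summit the two coincide, so the file silences `dupNamespace`.
set_option linter.dupNamespace false

namespace Summit.MatrixMultiplication.MatrixMultiplication.Theorems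

open Literature.Computability.AlgebraicComplexity

/-- **Subadditivity of the asymptotic rank under direct sum**, `R̃(s ⊕ t) ≤ R̃(s) + R̃(t)` for
3-tensors over `ℂ` with finite index types: closes route item `AsymptoticRankSubadditive`
(Strassen 1988, Thm. 3.8 via duality: an `F ∈ Δ` attaining `R̃(s ⊕ t)` is additive and bounded by
`R̃` on each summand). -/
theorem asymptoticRankSubadditive_proof :
    Summit.MatrixMultiplication.MatrixMultiplication.Theses.StrassenDefect.AsymptoticRankSubadditive := by
  unfold Summit.MatrixMultiplication.MatrixMultiplication.Theses.StrassenDefect.AsymptoticRankSubadditive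
  intro ι κ μ ι' κ' μ' _ _ _ _ _ _ s t
  obtain ⟨F, hF, hFst⟩ := (strassen_duality_asymptoticRank_holds ℂ (directSumTensor s t)).2
  rw [← hFst, hF.map_directSum s t]
  exact add_le_add ((strassen_duality_asymptoticRank_holds ℂ s).1 F hF)
    ((strassen_duality_asymptoticRank_holds ℂ t).1 F hF)

end Summit.MatrixMultiplication.MatrixMultiplication.Theorems
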